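import Summits.BirchSwinnertonDyer.BirchSwinnertonDyer.Theorems.SylvesterTwoHeegnerIndexCoupledDualityNoEigenvector
import Summits.BirchSwinnertonDyer.BirchSwinnertonDyer.Theorems.SylvesterTwoHeegnerIndexCoupledDualityReciprocityOfPoitouTate
import Literature.NumberTheory.EllipticCurves.SelmerTorsionCMOperatorJZero
import Literature.NumberTheory.EllipticCurves.ShaRestrictionJZeroDescent
import Literature.NumberTheory.EllipticCurves.NonvanishingTwistsWaldspurgerOfHoffsteinLuo
import Literature.NumberTheory.EllipticCurves.JZeroKolyvaginPrimes
import Summits.BirchSwinnertonDyer.Rank1Residual.X12.CubeSumFamilies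
import HarnessLib

/-!
# Leaf (L2A/B) of VARIANT K at `p = 2` for `j = 0` curves over `K ∋ ω`: Gross's Prop. 8.2 at an
# inert Kolyvagin prime, UNCONDITIONAL modulo the conductor divisibility of the level

For crux `UpperOffV0HSYPlus` (stmt-BirchSwinnertonDyer-19804): the binders `hL2A` / `hL2B` of THEOREM
K2's deduction `SylvesterTwoCoupledDescentAtTwo.selmerGroup_eq_bot_and_le_closure_of_coupledLeaves`
read, for `X` one of the short models `E_{3p²} = cubeSumCurve (3p²)`, `E_p = cubeSumCurve p`:
for every Kolyvagin prime `ℓ` (predicate `Kol`), every `d ∈ H¹(K, X[2])` Selmer at all finite `v ∌ ℓ`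
and at `∞` but NOT Selmer at `λ = (ℓ)`, every Selmer class `s` is locally trivial at `λ`.

`hL2_of_jZero` proves this for EVERY `j = 0` short model `X = ⟨0, 0, 0, 0, b⟩` over `ℚ` (elliptic),
`K ∋ ω` quadratic (`ω² + ω + 1 = 0`), level `N_X` with `X.conductorNorm ℤ ∣ N_X`, and any `Kol` implying
the six clauses of `IsKolyvaginPrime N_X X K 2 ℓ` — by assembling:
* (R)_1 UNCONDITIONALLY: `SylvesterTwoCoupledDuality.kolyvaginReciprocityM_of_goodReduction`
  (Poitou–Tate is the tree theorem `GaloisCohomology.poitouTate_sum_localTatePairing_eq_zero_holds`),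
  with good reduction of `X/K` at `λ` from `ℓ ∤ N_X ⊇ N(X)` (`hasGoodReductionAt_of_not_dvd_conductorNorm`
  + `hasGoodReductionAt_baseChange_of_hasGoodReductionAt_rat`);
* the `[ζ]`-isogeny `φ` of `X_K` (`JZero.exists_cm_isogeny_of_eq`), its restriction `fn` to `X[2]`,
  `H¹(fn)` preserving every local Selmer condition (`resH1Hom_id_mem_selmerLocalKer` with the isogeny's
  local points maps) — so (R) holds for `H¹(fn) d` as well —, and `fn` WITHOUT EIGENVECTOR on `X[2]`
  (`fn² + fn + 1 = 0`, `2·X[2] = 0`);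
* `SylvesterTwoCoupledDuality.mem_torsionLocalKer_of_reciprocity_of_noEigenvector` (Prop. 8.2 without
  eigenlines).
`hL2_cubeSumCurve` is the instance `X = cubeSumCurve c`, `c ≠ 0`. Displayed for the rows: ONLY
`X.conductorNorm ℤ ∣ N_X`. Theorem-only; nothing asserted on 19804; no label moves; BSD not claimed.

References: Gross 1991 Prop. 8.2, (7.6), §9 [GrossLMS1991]; McCallum 1991 Prop. 2.2, Lemma 5.3
[McCallumLMS1991]; Milne ADT I Thm. 4.10(b) [MilneADT2006]; Silverman AEC III.10.1 [SilvermanAEC2009].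
-/

set_option linter.dupNamespace false -- Summits modules are `Summit.<Summit>.<Problem>…` by design

noncomputable section

open scoped Classical
open WeierstrassCurve NumberField IsDedekindDomain Field
open Literature.NumberTheory.EllipticCurves Literature.NumberTheory.GaloisRepresentations
open Literature.NumberTheory.EllipticCurves.HuShuYin2019

namespace Summit.BirchSwinnertonDyer.BirchSwinnertonDyer.Theorems.SylvesterTwoCoupledDuality

variable {K : Type} [Field K] [NumberField K]

/-- **(L2) at `p = 2` for a `j = 0` short model `X = ⟨0, 0, 0, 0, b⟩` over `ℚ`** (elliptic), `K ∋ ω`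
quadratic, `X.conductorNorm ℤ ∣ N_X`, `Kol` implying the Kolyvagin-prime clauses at level `N_X`: for every
`ℓ` with `Kol ℓ`, every `d ∈ H¹(K, X[2])` Selmer at the finite places `v ∌ ℓ` and at `∞` and NOT Selmer
at a place `v ∋ ℓ`, every `s ∈ Sel₂(X_K/K)` is locally trivial at `v` — the `hL2X` binder of
`selmerGroup_eq_bot_and_le_closure_of_coupledLeaves` VERBATIM. Unconditional (Poitou–Tate is a tree
theorem). [cite: GrossLMS1991, Prop. 8.2] -/
theorem hL2_of_jZero (X : WeierstrassCurve ℚ) [X.IsElliptic] (ha₁ : X.a₁ = 0) (ha₂ : X.a₂ = 0)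
    (ha₃ : X.a₃ = 0) (ha₄ : X.a₄ = 0) {ω : K} (hω : ω ^ 2 + ω + 1 = 0)
    (h2 : Module.finrank ℚ K = 2) {NX : ℕ} (hN : X.conductorNorm ℤ ∣ NX) (Kol : ℕ → Prop)
    (hKol : ∀ ℓ, Kol ℓ → ℓ.Prime ∧ ¬ ℓ ∣ NX ∧ ¬ ((ℓ : ℤ) ∣ NumberField.discr K) ∧ ℓ ≠ 2 ∧
      (Ideal.span {(ℓ : 𝓞 K)}).IsPrime ∧ FrobEqFrobInfty X K 2 ℓ) :
    ∀ ℓ, Kol ℓ → ∀ d : galH1Torsion (X.baseChange K) (2 : ℕ),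
      (∀ v : HeightOneSpectrum (𝓞 K), (ℓ : 𝓞 K) ∉ v.asIdeal →
        d ∈ selmerLocalKer (X.baseChange K) (v.adicCompletion K) (2 : ℕ)) →
      (∀ x : InfinitePlace K, d ∈ selmerLocalKer (X.baseChange K) x.Completion (2 : ℕ)) →
      ∀ v : HeightOneSpectrum (𝓞 K), (ℓ : 𝓞 K) ∈ v.asIdeal →
        d ∉ selmerLocalKer (X.baseChange K) (v.adicCompletion K) (2 : ℕ) →
        ∀ s ∈ selmerGroup (X.baseChange K) (2 : ℕ),
          s ∈ (X.baseChange K).torsionLocalKer (v.adicCompletion K) (2 : ℕ) := by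
  intro ℓ hKℓ d hdfin hdinf v hv hdv s hs
  obtain ⟨hℓp, hℓN, hℓd, hℓ2, hℓP, hFrob⟩ := hKol ℓ hKℓ
  have hℓ : IsKolyvaginPrime NX X K 2 ℓ := ⟨hℓp, hℓN, hℓd, hℓ2, hℓP, hFrob⟩
  have hvw : v = hℓ.place := hℓ.mem_iff.mp hv
  subst hvw
  have hK : IsImaginaryQuadratic K := JZero.isImaginaryQuadratic_of_sq_add_self_add_one hω h2
  haveI hXK : (X.baseChange K).IsElliptic := inferInstanceAs (X.map (algebraMap ℚ K)).IsElliptic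
  -- ### good reduction of `X/K` at `λ` (`ℓ ∤ N_X ⊇ N(X)`)
  have hgoodQ : X.HasGoodReductionAt (hℓ.place.under (𝓞 ℚ)) := by
    haveI : Fact ℓ.Prime := ⟨hℓp⟩
    refine hasGoodReductionAt_of_not_dvd_conductorNorm X _ fun h ↦ hℓN ?_
    rw [Literature.NumberTheory.EllipticCurves.primesEquiv_eq_of_natCast_mem hℓp
      hℓ.natCast_mem_under] at h
    exact h.trans hN
  haveI : hℓ.place.asIdeal.LiesOver (hℓ.place.under (𝓞 ℚ)).asIdeal := ⟨rfl⟩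
  have hgood : (X.baseChange K).HasGoodReductionAt hℓ.place :=
    hasGoodReductionAt_baseChange_of_hasGoodReductionAt_rat X _ hℓ.place hgoodQ
  have hbad : hℓ.place ∉ (X.baseChange K).badPlaces (𝓞 K) := by
    rw [mem_badPlaces_iff, not_not]; exact hgood
  -- ### the `[ζ]`-isogeny of `X_K`, its restriction `fn` to `X[2]`
  have hXeq : X.baseChange K = ⟨0, 0, 0, 0, algebraMap ℚ K X.a₆⟩ := by
    ext
    · change algebraMap ℚ K X.a₁ = 0; rw [ha₁, map_zero]
    · change algebraMap ℚ K X.a₂ = 0; rw [ha₂, map_zero]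
    · change algebraMap ℚ K X.a₃ = 0; rw [ha₃, map_zero]
    · change algebraMap ℚ K X.a₄ = 0; rw [ha₄, map_zero]
    · rfl
  obtain ⟨φ, -, hrel⟩ := JZero.exists_cm_isogeny_of_eq (V := X.baseChange K) hXeq
    (JZero.exists_aut_apply_eq_sq K hω h2).1
  let fn : geomTorsion (X.baseChange K) ((2 : ℕ) : ℤ) →+ geomTorsion (X.baseChange K) ((2 : ℕ) : ℤ) :=
    (φ.toAddMonoidHom.comp (geomTorsion (X.baseChange K) ((2 : ℕ) : ℤ)).subtype).codRestrict _
      fun P ↦ by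
        simp only [AddMonoidHom.coe_comp, AddSubgroup.coe_subtype, Function.comp_apply]
        rw [mem_geomTorsion_iff, ← map_zsmul, (mem_geomTorsion_iff _ _ _).mp P.2, map_zero]
  have hcoe : ∀ P : geomTorsion (X.baseChange K) ((2 : ℕ) : ℤ),
      ((fn P : geomTorsion (X.baseChange K) ((2 : ℕ) : ℤ)) : geomPoints (X.baseChange K)) = φ P :=
    fun _ ↦ rfl
  have hfn : ∀ (g : absoluteGaloisGroup K) (P : geomTorsion (X.baseChange K) ((2 : ℕ) : ℤ)),
      fn (ContinuousMonoidHom.id _ g • P) = g • fn P := by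
    intro g P
    apply Subtype.ext
    rw [hcoe, AddSubgroup.torsionBy.coe_smul, AddSubgroup.torsionBy.coe_smul, hcoe]
    exact φ.equivariant g P
  -- `fn` has no eigenvector on `X[2]`: `fn² + fn + 1 = 0` and `2 · X[2] = 0`
  have h2T : ∀ t : geomTorsion (X.baseChange K) ((2 : ℕ) : ℤ), (2 : ℤ) • t = 0 := fun t ↦ by
    apply Subtype.ext
    rw [AddSubgroupClass.coe_zsmul, ZeroMemClass.coe_zero]
    exact (mem_geomTorsion_iff _ _ _).mp t.2
  have hreln : ∀ P : geomTorsion (X.baseChange K) ((2 : ℕ) : ℤ), fn (fn P) + fn P + P = 0 := by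
    intro P
    apply Subtype.ext
    change ((fn (fn P) : geomTorsion (X.baseChange K) _) : geomPoints (X.baseChange K)) +
      ((fn P : geomTorsion (X.baseChange K) _) : geomPoints (X.baseChange K)) +
      (P : geomPoints (X.baseChange K)) = 0
    exact hrel P
  have hnoeig : ∀ (t : geomTorsion (X.baseChange K) ((2 : ℕ) : ℤ)) (k : ℤ), fn t = k • t → t = 0 := by
    intro t k hk
    -- `k • t ∈ {0, t}`; `fn t = 0 ⇒ t = -(fn (fn t)) - fn t = 0`; `fn t = t ⇒ 3 t = 0 ⇒ t = 0`
    have hr := hreln t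
    obtain ⟨m, hm⟩ : ∃ m : ℤ, k = k % 2 + m * 2 := ⟨k / 2, by omega⟩
    have hkt : k • t = (k % 2) • t := by
      rw [hm, add_zsmul, mul_zsmul, h2T, zsmul_zero, add_zero]
      congr 1; omega
    rcases Int.emod_two_eq_zero_or_one k with h0 | h1
    · rw [hkt, h0, zero_zsmul] at hk
      rw [hk, map_zero, zero_add, zero_add] at hr
      exact hr
    · rw [hkt, h1, one_zsmul] at hk
      rw [hk, hk, ← two_zsmul, h2T, zero_add] at hr
      exact hr
  -- `H¹(fn)` preserves every local Selmer condition
  have hwloc : ∀ (E : Type) [Field E] [Algebra K E] {c : galH1Torsion (X.baseChange K) ((2 : ℕ) : ℤ)},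
      c ∈ selmerLocalKer (X.baseChange K) E ((2 : ℕ) : ℤ) →
      resH1Hom (ContinuousMonoidHom.id _) fn hfn c ∈ selmerLocalKer (X.baseChange K) E ((2 : ℕ) : ℤ) := by
    intro E _ _ c hc
    obtain ⟨fE, hfE, hcomp⟩ := φ.hasLocalPointsMaps_toAddMonoidHom E
    exact resH1Hom_id_mem_selmerLocalKer _ E fn hfn φ.toAddMonoidHom hcoe fE hfE hcomp hc
  -- ### reciprocity (R)_1 from Poitou–Tate, for `(s, d)` and `(s, H¹(fn) d)`
  obtain ⟨A, _, e, halt, hnd, hRM⟩ :=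
    kolyvaginReciprocityM_of_goodReduction NX X K Nat.prime_two (M := 1) le_rfl hℓ hbad
  have hR := hRM s hs d hdfin hdinf
  have hR' := hRM s hs (resH1Hom (ContinuousMonoidHom.id _) fn hfn d)
    (fun v hv ↦ hwloc _ (hdfin v hv)) (fun x ↦ hwloc _ (hdinf x))
  -- ### Prop. 8.2 without eigenlines
  exact mem_torsionLocalKer_of_reciprocity_of_noEigenvector X hK Nat.prime_two hℓ hgood e halt hnd
    fn hfn hnoeig hdv hs hR hR'

/-- **(L2) at `p = 2` for the Sylvester curves `X = cubeSumCurve c`** (`c ≠ 0`; `c = p` gives `hL2B`,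
`c = 3p²` gives `hL2A` of `selmerGroup_eq_bot_and_le_closure_of_coupledLeaves`), `K ∋ ω` quadratic,
`(cubeSumCurve c).conductorNorm ℤ ∣ N_X`. Unconditional. [cite: GrossLMS1991, Prop. 8.2] -/
theorem hL2_cubeSumCurve {c : ℚ} (hc : c ≠ 0) {ω : K} (hω : ω ^ 2 + ω + 1 = 0)
    (h2 : Module.finrank ℚ K = 2) {NX : ℕ} (hN : (cubeSumCurve c).conductorNorm ℤ ∣ NX)
    (Kol : ℕ → Prop)
    (hKol : ∀ ℓ, Kol ℓ → ℓ.Prime ∧ ¬ ℓ ∣ NX ∧ ¬ ((ℓ : ℤ) ∣ NumberField.discr K) ∧ ℓ ≠ 2 ∧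
      (Ideal.span {(ℓ : 𝓞 K)}).IsPrime ∧ FrobEqFrobInfty (cubeSumCurve c) K 2 ℓ) :
    ∀ ℓ, Kol ℓ → ∀ d : galH1Torsion ((cubeSumCurve c).baseChange K) (2 : ℕ),
      (∀ v : HeightOneSpectrum (𝓞 K), (ℓ : 𝓞 K) ∉ v.asIdeal →
        d ∈ selmerLocalKer ((cubeSumCurve c).baseChange K) (v.adicCompletion K) (2 : ℕ)) →
      (∀ x : InfinitePlace K,
        d ∈ selmerLocalKer ((cubeSumCurve c).baseChange K) x.Completion (2 : ℕ)) →
      ∀ v : HeightOneSpectrum (𝓞 K), (ℓ : 𝓞 K) ∈ v.asIdeal →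
        d ∉ selmerLocalKer ((cubeSumCurve c).baseChange K) (v.adicCompletion K) (2 : ℕ) →
        ∀ s ∈ selmerGroup ((cubeSumCurve c).baseChange K) (2 : ℕ),
          s ∈ ((cubeSumCurve c).baseChange K).torsionLocalKer (v.adicCompletion K) (2 : ℕ) :=
  haveI := Rank1Residual.X12.CubeSumFamilies.isElliptic_cubeSumCurve hc
  hL2_of_jZero (cubeSumCurve c) rfl rfl rfl rfl hω h2 hN Kol hKol

end Summit.BirchSwinnertonDyer.BirchSwinnertonDyer.Theorems.SylvesterTwoCoupledDuality

end
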